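import Mathlib.NumberTheory.ArithmeticFunction.Liouville
import Literature.NumberTheory.LFunctions.LiouvilleSumClassicalBound
import HarnessLib

/-!
# Route LiouvilleSarnak — `AlignedTypeI` (stmt-ValiantsHypothesis-21040), transposed rung: preliminaries

Bookkeeping for `LiouvilleSarnakAlignedTypeITransposed.lean` (the interval side of the aligned cut, from
Matomäki–Radziwiłł): trivial bounds for Liouville sums over finite sets, block sums as interval sums, the comparison of
a block `[s, s+h)` with a shifted window `[s+u, s+u+h]`, the injectivity count for thickened block starts, the prime
number theorem for `λ` in threshold form (from the tree's PROVED `abs_sum_liouville_le_logPow`), and the threshold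
`h₀(ε)` past which the correction `C' log log h / log h` and the exceptional-set density of Matomäki–Radziwiłł's
Theorem 1 are below the working tolerance.  Everything here is elementary and PROVED; nothing touches `VP ≠ VNP`.
-/

set_option linter.dupNamespace false

noncomputable section

namespace Summit.ValiantsHypothesis.ValiantsHypothesis.Theorems.LiouvilleSarnak.AlignedTypeI.Transposed

open ArithmeticFunction Finset Filter
open Literature.NumberTheory.LFunctions

/-! ## §1 Trivial bounds and interval bookkeeping -/

/-- `|∑_{n ∈ s} λ(n)| ≤ #s`. [folklore] -/
theorem abs_sum_liouville_le_card (s : Finset ℕ) :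
    |∑ n ∈ s, (liouville n : ℝ)| ≤ #s := by
  calc |∑ n ∈ s, (liouville n : ℝ)| ≤ ∑ n ∈ s, |(liouville n : ℝ)| := abs_sum_le_sum_abs _ _
    _ ≤ ∑ n ∈ s, (1 : ℝ) := sum_le_sum fun n _ => LiouvilleSum.abs_liouville_le_one n
    _ = #s := by simp

/-- A block sum `∑_{a < h} λ(a + s)` is the interval sum over `[s, s + h)`. [folklore] -/
theorem sum_range_shift_eq_sum_Ico (g : ℕ → ℝ) (s h : ℕ) :
    ∑ a ∈ range h, g (a + s) = ∑ n ∈ Ico s (s + h), g n := by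
  rw [sum_Ico_eq_sum_range, Nat.add_sub_cancel_left]
  exact sum_congr rfl fun a _ => by rw [add_comm]

/-- Block versus shifted window: for `u ≤ h`,
`|∑_{n ∈ [s, s+h)} λ(n) - ∑_{n ∈ [s+u, s+u+h]} λ(n)| ≤ 2u + 1`. [folklore] -/
theorem abs_blockSum_sub_windowSum_le (s h u : ℕ) (hu : u ≤ h) :
    |∑ n ∈ Ico s (s + h), (liouville n : ℝ) - ∑ n ∈ Icc (s + u) (s + u + h), (liouville n : ℝ)|
      ≤ 2 * u + 1 := by
  have h1 : ∑ n ∈ Ico s (s + h), (liouville n : ℝ)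
      = ∑ n ∈ Ico s (s + u), (liouville n : ℝ) + ∑ n ∈ Ico (s + u) (s + h), (liouville n : ℝ) :=
    (sum_Ico_consecutive _ (by omega) (by omega)).symm
  have h2 : ∑ n ∈ Icc (s + u) (s + u + h), (liouville n : ℝ)
      = ∑ n ∈ Ico (s + u) (s + h), (liouville n : ℝ)
        + ∑ n ∈ Ico (s + h) (s + u + h + 1), (liouville n : ℝ) := by
    rw [← Finset.Ico_add_one_right_eq_Icc]
    exact (sum_Ico_consecutive _ (by omega) (by omega)).symm
  rw [h1, h2]
  have e : ∑ n ∈ Ico s (s + u), (liouville n : ℝ) + ∑ n ∈ Ico (s + u) (s + h), (liouville n : ℝ)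
      - (∑ n ∈ Ico (s + u) (s + h), (liouville n : ℝ)
        + ∑ n ∈ Ico (s + h) (s + u + h + 1), (liouville n : ℝ))
      = ∑ n ∈ Ico s (s + u), (liouville n : ℝ)
        - ∑ n ∈ Ico (s + h) (s + u + h + 1), (liouville n : ℝ) := by ring
  rw [e]
  calc |∑ n ∈ Ico s (s + u), (liouville n : ℝ) - ∑ n ∈ Ico (s + h) (s + u + h + 1), (liouville n : ℝ)|
      ≤ |∑ n ∈ Ico s (s + u), (liouville n : ℝ)|
        + |∑ n ∈ Ico (s + h) (s + u + h + 1), (liouville n : ℝ)| := abs_sub _ _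
    _ ≤ #(Ico s (s + u)) + #(Ico (s + h) (s + u + h + 1)) :=
        add_le_add (abs_sum_liouville_le_card _) (abs_sum_liouville_le_card _)
    _ = 2 * u + 1 := by
        rw [Nat.card_Ico, Nat.card_Ico]
        push_cast [show s + u - s = u by omega, show s + u + h + 1 - (s + h) = u + 1 by omega]
        ring

/-- Counting thickened block starts inside a set: for `t < h` the points `h b + 1 + u`, `u ≤ t`, are
pairwise distinct, so `∑_{b ∈ F} #{u ≤ t : h b + 1 + u ∈ E} ≤ #E`. [folklore] -/
theorem sum_sum_indicator_le_card (E F : Finset ℕ) {h t : ℕ} (ht : t < h) :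
    ∑ b ∈ F, ∑ u ∈ range (t + 1), (if h * b + 1 + u ∈ E then (1 : ℝ) else 0) ≤ #E := by
  rw [← sum_product (s := F) (t := range (t + 1)) (f := fun p => if h * p.1 + 1 + p.2 ∈ E then (1 : ℝ) else 0),
    sum_boole]
  have hpos : 0 < h := by omega
  exact_mod_cast card_le_card_of_injOn (fun p : ℕ × ℕ => h * p.1 + 1 + p.2)
    (fun p hp => (mem_filter.1 hp).2)
    (fun p hp p' hp' hpp => by
      have hu : p.2 < h := lt_of_lt_of_le (mem_range.1 (mem_product.1 (mem_filter.1 hp).1).2) ht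
      have hu' : p'.2 < h := lt_of_lt_of_le (mem_range.1 (mem_product.1 (mem_filter.1 hp').1).2) ht
      have e : h * p.1 + p.2 = h * p'.1 + p'.2 := by
        have := hpp; simp only at this; omega
      have e1 : p.1 = p'.1 := by
        have := congrArg (· / h) e
        simpa [Nat.mul_add_div hpos, Nat.div_eq_of_lt hu, Nat.div_eq_of_lt hu'] using this
      have e2 : p.2 = p'.2 := by
        have := congrArg (· % h) e
        simpa [Nat.mul_add_mod, Nat.mod_eq_of_lt hu, Nat.mod_eq_of_lt hu'] using this
      exact Prod.ext e1 e2)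


/-! ## §2 Thresholds -/

/-- The prime number theorem for `λ` in threshold form: for every `η > 0` there is `y₀ ≥ 2` with
`|∑_{n ≤ y} λ(n)| ≤ η y` for all real `y ≥ y₀` (from the tree's `|∑_{n≤x} λ(n)| ≤ C x / log x`). [folklore] -/
theorem exists_pnt_threshold {η : ℝ} (hη : 0 < η) :
    ∃ y₀ : ℝ, 2 ≤ y₀ ∧ ∀ y : ℝ, y₀ ≤ y → |∑ n ∈ Ioc 0 ⌊y⌋₊, (liouville n : ℝ)| ≤ η * y := by
  obtain ⟨C₁, hC₁⟩ := abs_sum_liouville_le_logPow (1 : ℝ)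
  refine ⟨max 2 (Real.exp (max C₁ 0 / η)), le_max_left _ _, fun y hy => ?_⟩
  have hy2 : 2 ≤ y := (le_max_left _ _).trans hy
  have hlogy : max C₁ 0 / η ≤ Real.log y := by
    rw [← Real.log_exp (max C₁ 0 / η)]
    exact Real.log_le_log (Real.exp_pos _) ((le_max_right _ _).trans hy)
  have hlogpos : 0 < Real.log y := Real.log_pos (by linarith)
  calc |∑ n ∈ Ioc 0 ⌊y⌋₊, (liouville n : ℝ)| ≤ C₁ * y / Real.log y ^ (1 : ℝ) := hC₁ y hy2
    _ = C₁ * y / Real.log y := by rw [Real.rpow_one]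
    _ ≤ max C₁ 0 * y / Real.log y := by gcongr; exact le_max_left _ _
    _ ≤ η * y := by
        rw [div_le_iff₀ hlogpos]
        rw [div_le_iff₀ hη] at hlogy
        have hy0 : 0 ≤ y := by linarith
        have hprod := mul_le_mul_of_nonneg_right hlogy hy0
        have e : η * y * Real.log y = Real.log y * η * y := by ring
        rw [e]
        linarith

/-- The threshold `h₀` of the block argument: past it, `h ≥ y₀ + 1`, `δ h ≥ 1`, the correction
`C' log log h / log h` of Matomäki–Radziwiłł's Theorem 1 is `≤ δ`, and `C` times its exceptional-set density
`(log h)^{1/3}/(δ² h^{δ/25}) + 1/(δ² (log h)^{1/50})` is `≤ δ²`. [folklore] -/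
theorem exists_blocks_threshold (C C' y₀ : ℝ) {δ : ℝ} (hδ : 0 < δ) :
    ∃ h₀ : ℕ, ∀ h : ℕ, h₀ ≤ h →
      y₀ + 1 ≤ (h : ℝ) ∧ 1 ≤ δ * (h : ℝ) ∧ C' * Real.log (Real.log h) / Real.log h ≤ δ ∧
        C * (Real.log h ^ (1 / 3 : ℝ) / (δ ^ 2 * (h : ℝ) ^ (δ / 25))
          + 1 / (δ ^ 2 * Real.log h ^ (1 / 50 : ℝ))) ≤ δ ^ 2 := by
  have hhR : Tendsto (fun h : ℕ => (h : ℝ)) atTop atTop := tendsto_natCast_atTop_atTop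
  have ev1 : ∀ᶠ h : ℕ in atTop, y₀ + 1 ≤ (h : ℝ) := hhR.eventually_ge_atTop _
  have ev2 : ∀ᶠ h : ℕ in atTop, 1 ≤ δ * (h : ℝ) := (hhR.const_mul_atTop hδ).eventually_ge_atTop _
  have ev3 : ∀ᶠ h : ℕ in atTop, C' * Real.log (Real.log h) / Real.log h ≤ δ := by
    have hr : Tendsto (fun h : ℕ => C' * Real.log (Real.log h) / Real.log h) atTop (nhds 0) := by
      have := (Real.isLittleO_log_id_atTop.tendsto_div_nhds_zero.comp
        (Real.tendsto_log_atTop.comp hhR)).const_mul C'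
      rw [mul_zero] at this
      refine this.congr fun h => ?_
      simp only [Function.comp_apply, id]
      ring
    exact hr.eventually_le_const hδ
  have ev4 : ∀ᶠ h : ℕ in atTop, C * (Real.log h ^ (1 / 3 : ℝ) / (δ ^ 2 * (h : ℝ) ^ (δ / 25))
      + 1 / (δ ^ 2 * Real.log h ^ (1 / 50 : ℝ))) ≤ δ ^ 2 := by
    have hg : Tendsto (fun h : ℕ => C * (Real.log h ^ (1 / 3 : ℝ) / (δ ^ 2 * (h : ℝ) ^ (δ / 25))
        + 1 / (δ ^ 2 * Real.log h ^ (1 / 50 : ℝ)))) atTop (nhds 0) := by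
      have h1 : Tendsto (fun h : ℕ => Real.log h ^ (1 / 3 : ℝ) / (δ ^ 2 * (h : ℝ) ^ (δ / 25)))
          atTop (nhds 0) := by
        have := (((isLittleO_log_rpow_rpow_atTop (1 / 3 : ℝ)
          (by positivity : 0 < δ / 25)).tendsto_div_nhds_zero).comp hhR).div_const (δ ^ 2)
        rw [zero_div] at this
        refine this.congr fun h => ?_
        simp only [Function.comp_apply]
        rw [div_div, mul_comm]
      have h2 : Tendsto (fun h : ℕ => 1 / (δ ^ 2 * Real.log h ^ (1 / 50 : ℝ))) atTop (nhds 0) := by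
        simp_rw [one_div]
        refine Tendsto.inv_tendsto_atTop (Tendsto.const_mul_atTop (by positivity) ?_)
        exact (tendsto_rpow_atTop (by norm_num)).comp (Real.tendsto_log_atTop.comp hhR)
      have := (h1.add h2).const_mul C
      rw [add_zero, mul_zero] at this
      exact this
    exact hg.eventually_le_const (by positivity)
  obtain ⟨h₀, hh₀⟩ := eventually_atTop.1 (ev1.and (ev2.and (ev3.and ev4)))
  exact ⟨h₀, hh₀⟩

end Summit.ValiantsHypothesis.ValiantsHypothesis.Theorems.LiouvilleSarnak.AlignedTypeI.Transposed
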